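import Mathlib
import Summits.Ventures.PercRepro2.Defs
import Summits.Ventures.PercRepro2.Independence
import Summits.Ventures.PercRepro2.Harris
import Summits.Ventures.PercRepro2.Graph
import Summits.Ventures.PercRepro2.Exploration
import Summits.Ventures.PercRepro2.Events
import Summits.Ventures.PercRepro2.FourFunctions
import Summits.Ventures.PercRepro2.Induced
import Summits.Ventures.PercRepro2.Frontier
import Summits.Ventures.PercRepro2.ObsIndependence
import Summits.Ventures.PercRepro2.BHK
import Summits.Ventures.PercRepro2.BHKEvents
import Summits.Ventures.PercRepro2.OrderPreservation
import Summits.Ventures.PercRepro2.OrderPreservationDual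
import Summits.Ventures.PercRepro2.VdBKahn
import Summits.Ventures.PercRepro2.BHKAvoid
import Summits.Ventures.PercRepro2.R2PrimeThreeReduction
import Summits.Ventures.PercRepro2.YBridge
import Summits.Ventures.PercRepro2.Yu1Functionals
import Summits.Ventures.PercRepro2.Yu1Events
import Summits.Ventures.PercRepro2.Yu1
import Summits.Ventures.PercRepro2.LBSplit
import Summits.Ventures.PercRepro2.YDelta

/-!
# (SD): the up-set / increasing-functional form of (Yu1Δ) and (Yu2Δ)
(blind cell PercRepro2, typer-1; p1 2026-08-22T21:20:54Z / 21:25:02Z, lead g6 22:19:50Z)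

Light-first exploration `S = C(a₁)` on `R = {a₂, a₃ ∉ S}` with the functionals of `Yu1Functionals`
(`u(S) = P_{G∖S}(a₃ ∉ C(a₂))`, `β(S) = P_{G∖S}(b ∈ C(a₂))`, `1_b`) and the **signed weight**
`ψ = β − 1_b (1 − u)` (on `R`: `ψ = 1_{b∉S} β − 1_{b∈S} (1 − u)`).  The census rows (Yu1Δ), (Yu2Δ)
are the principal case `𝒰 = {S | o ∈ S}` of the family

* `SDLight 𝒰`: `[P(b ∈ C₂, C₁ ∈ 𝒰, R) − P(b ∈ C₁, C₁ ∈ 𝒰, T)] · P(PD) ≤ P(PD, C₁ ∈ 𝒰) · W`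
  (`W = M₂ + Δ_T`), i.e. `E[1_𝒰 ψ; R] · E[u; R] ≤ E[1_𝒰 u; R] · E[ψ; R]` (`SDLight_iff_fun`);
* `SDHeavy 𝒰`: the mirror with the heavy cluster `C₂` explored on `R_h = {a₁, a₃ ∉ C₂}`,
  `T′ = {a₂ ∉ C₁, a₃ ∈ C₁}`;
* `SDLightUp` / `SDHeavyUp`: the statement of record — `SDLight 𝒰` for **every up-set** `𝒰` of
  vertex sets ("the maximum of `Λ(𝒰) = E[ψ; R ∩ 𝒰] / P(PD ∩ 𝒰)` over up-sets is attained at `Ω`");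
  `SDLightFun F`: the increasing-functional form `E[F ψ; R] · P(PD) ≤ E[F u; R] · W`.

Facts: `SDLight_principal_iff` (`𝒰 = {S | o ∈ S}` is exactly `Yu1Delta`), `SDLight_univ`
(`𝒰 = univ`: equality, `Λ(Ω) = W / P(PD)`), `SDLight_iff_fun` (up-set form = functional form at
`F = 1_𝒰`), `Yu1Delta_of_SDLightUp`, and the tower identities `tower_Ub`, `tower_UbT`, `tower_PDU`,
`tower_Upsi`.  The heavy mirror facts (`SDHeavy_principal_iff` = `Yu2Delta`, `SDHeavy_univ_iff`,
`Yu2Delta_of_SDHeavyUp`) are in `SDHeavy.lean`.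
-/

namespace Summit.Ventures.PercRepro2

open UnionCluster Yu1

section SDDefs

variable {V : Type*} {E : Type*} [Fintype E] [DecidableEq E] [Fintype V] [DecidableEq V]
  {R : Type*} [Field R] [LinearOrder R] [IsStrictOrderedRing R]

/-- The signed weight `ψ(S) = β(S) − 1_b(S) (1 − u(S))` of the light exploration. -/
noncomputable def psi (p : E → R) (ends : E → Sym2 V) (a₂ a₃ b : V) : Set V → R :=
  fun S => beta p ends a₂ b S - ind b S * (1 - u p ends a₂ a₃ S)

/-- **(SD)_l at the family `𝒰`** of vertex sets:
`[P(b ∈ C₂, C₁ ∈ 𝒰, R) − P(b ∈ C₁, C₁ ∈ 𝒰, T)] · P(PD) ≤ P(PD, C₁ ∈ 𝒰) · W`. -/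
def SDLight (p : E → R) (ends : E → Sym2 V) (a₁ a₂ a₃ b : V) (𝒰 : Set (Set V)) : Prop :=
  (prob p (connEvent ends a₂ b ∩ clusterInEvent ends a₁ 𝒰 ∩ avoidAll ends a₁ {a₂, a₃}) -
      prob p (connEvent ends a₁ b ∩ clusterInEvent ends a₁ 𝒰 ∩ TEvent ends a₁ a₂ a₃)) *
      prob p (PDEvent ends a₁ a₂ a₃) ≤
    prob p (PDEvent ends a₁ a₂ a₃ ∩ clusterInEvent ends a₁ 𝒰) *
      (massM2 p ends a₁ a₂ a₃ b + deltaT p ends a₁ a₂ a₃ b)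

/-- **(SD)_h at the family `𝒰`** (heavy cluster `C₂` explored on `R_h = {a₁, a₃ ∉ C₂}`,
`T′ = TEvent a₂ a₁ a₃ = {a₂ ∉ C₁, a₃ ∈ C₁}`):
`[P(b ∈ C₁, C₂ ∈ 𝒰, R_h) − P(b ∈ C₂, C₂ ∈ 𝒰, T′)] · P(PD) ≤ P(PD, C₂ ∈ 𝒰) · W`. -/
def SDHeavy (p : E → R) (ends : E → Sym2 V) (a₁ a₂ a₃ b : V) (𝒰 : Set (Set V)) : Prop :=
  (prob p (connEvent ends a₁ b ∩ clusterInEvent ends a₂ 𝒰 ∩ avoidAll ends a₂ {a₁, a₃}) -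
      prob p (connEvent ends a₂ b ∩ clusterInEvent ends a₂ 𝒰 ∩ TEvent ends a₂ a₁ a₃)) *
      prob p (PDEvent ends a₁ a₂ a₃) ≤
    prob p (PDEvent ends a₁ a₂ a₃ ∩ clusterInEvent ends a₂ 𝒰) *
      (massM2 p ends a₁ a₂ a₃ b + deltaT p ends a₁ a₂ a₃ b)

/-- **(SD)_l for every up-set**: the statement of record (p1 21:25Z). -/
def SDLightUp (p : E → R) (ends : E → Sym2 V) (a₁ a₂ a₃ b : V) : Prop :=
  ∀ 𝒰 : Set (Set V), IsUpperSet 𝒰 → SDLight p ends a₁ a₂ a₃ b 𝒰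

/-- **(SD)_h for every up-set**. -/
def SDHeavyUp (p : E → R) (ends : E → Sym2 V) (a₁ a₂ a₃ b : V) : Prop :=
  ∀ 𝒰 : Set (Set V), IsUpperSet 𝒰 → SDHeavy p ends a₁ a₂ a₃ b 𝒰

/-- **(SD)_l in functional form** at `F : Set V → R`:
`E[F(C₁) ψ(C₁); R] · P(PD) ≤ E[F(C₁) u(C₁); R] · W`. -/
def SDLightFun (p : E → R) (ends : E → Sym2 V) (a₁ a₂ a₃ b : V) (F : Set V → R) : Prop :=
  expect p (fun ω => F (cluster ends ω a₁) * psi p ends a₂ a₃ b (cluster ends ω a₁) *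
      (avoidAll ends a₁ {a₂, a₃}).indicator 1 ω) * prob p (PDEvent ends a₁ a₂ a₃) ≤
    expect p (fun ω => F (cluster ends ω a₁) * u p ends a₂ a₃ (cluster ends ω a₁) *
      (avoidAll ends a₁ {a₂, a₃}).indicator 1 ω) *
      (massM2 p ends a₁ a₂ a₃ b + deltaT p ends a₁ a₂ a₃ b)

/-- **(SD)_l for every increasing non-negative functional** (p1 21:20Z). -/
def SDLightFunUp (p : E → R) (ends : E → Sym2 V) (a₁ a₂ a₃ b : V) : Prop :=
  ∀ F : Set V → R, Monotone F → (∀ S, 0 ≤ F S) → SDLightFun p ends a₁ a₂ a₃ b F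

end SDDefs

section SDEvents

variable {V : Type*} {E : Type*} [Fintype E] [DecidableEq E] [Fintype V] [DecidableEq V]
  {R : Type*} [Field R] [LinearOrder R] [IsStrictOrderedRing R]

omit [Fintype E] [DecidableEq E] [Fintype V] [DecidableEq V] in
/-- The principal up-set `{S | o ∈ S}` at the root `x` is the connection event `{x ↔ o}`. -/
lemma clusterInEvent_principal (ends : E → Sym2 V) (x o : V) :
    clusterInEvent ends x {S | o ∈ S} = connEvent ends x o := by
  ext ω
  simp [clusterInEvent]

omit [Fintype E] [DecidableEq E] [Fintype V] [DecidableEq V] in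
/-- `{C(x) ∈ univ}` is everything. -/
lemma clusterInEvent_univ (ends : E → Sym2 V) (x : V) :
    clusterInEvent ends x (Set.univ : Set (Set V)) = Set.univ := by
  ext ω
  simp [clusterInEvent]

omit [Fintype E] [DecidableEq E] [Fintype V] in
/-- `{b ∈ C₂} ∩ {C₁ ∈ 𝒰} ∩ R` as a two-cluster event. -/
lemma Ub_event_eq (ends : E → Sym2 V) (a₁ a₂ a₃ b : V) (𝒰 : Set (Set V)) :
    clusterInEvent ends a₁ 𝒰 ∩ clusterInEvent ends a₂ {W | b ∈ W} ∩ avoidAll ends a₁ {a₂, a₃} =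
      connEvent ends a₂ b ∩ clusterInEvent ends a₁ 𝒰 ∩ avoidAll ends a₁ {a₂, a₃} := by
  ext ω
  simp only [clusterInEvent, Set.mem_inter_iff, Set.mem_setOf_eq, mem_cluster, mem_connEvent]
  tauto

omit [Fintype E] [DecidableEq E] [Fintype V] in
/-- `{b ∈ C₁} ∩ {C₁ ∈ 𝒰} ∩ T` as a two-cluster event (`C₂ ∈ {a₃ ∈ ·}`). -/
lemma UbT_event_eq (ends : E → Sym2 V) (a₁ a₂ a₃ b : V) (𝒰 : Set (Set V)) :
    clusterInEvent ends a₁ (𝒰 ∩ {W | b ∈ W}) ∩ clusterInEvent ends a₂ {W | a₃ ∈ W} ∩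
        avoidAll ends a₁ {a₂, a₃} =
      connEvent ends a₁ b ∩ clusterInEvent ends a₁ 𝒰 ∩ TEvent ends a₁ a₂ a₃ := by
  have h := rb_event_eq ends a₁ a₂ a₃ b
  ext ω
  have key := Set.ext_iff.1 h ω
  simp only [clusterInEvent, Set.mem_inter_iff, Set.mem_setOf_eq, mem_cluster, mem_connEvent]
    at key ⊢
  tauto

omit [Fintype E] [DecidableEq E] [Fintype V] in
/-- `PD ∩ {C₁ ∈ 𝒰}` as a two-cluster event (`C₂ ∈ {a₃ ∉ ·}`). -/
lemma PDU_event_eq (ends : E → Sym2 V) (a₁ a₂ a₃ : V) (𝒰 : Set (Set V)) :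
    clusterInEvent ends a₁ 𝒰 ∩ clusterInEvent ends a₂ {W | a₃ ∉ W} ∩ avoidAll ends a₁ {a₂, a₃} =
      PDEvent ends a₁ a₂ a₃ ∩ clusterInEvent ends a₁ 𝒰 := by
  have h := PD_event_eq ends a₁ a₂ a₃
  ext ω
  have key := Set.ext_iff.1 h ω
  simp only [clusterInEvent, Set.mem_inter_iff, Set.mem_setOf_eq, Set.mem_univ, true_and,
    mem_cluster] at key ⊢
  tauto

omit [LinearOrder R] [IsStrictOrderedRing R] in
/-- Tower identity: `P(b ∈ C₂, C₁ ∈ 𝒰, R) = E[1_𝒰(C₁) β(C₁); R]`. -/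
lemma tower_Ub (p : E → R) (ends : E → Sym2 V) (a₁ a₂ a₃ b : V) (𝒰 : Set (Set V)) :
    prob p (connEvent ends a₂ b ∩ clusterInEvent ends a₁ 𝒰 ∩ avoidAll ends a₁ {a₂, a₃}) =
      expect p (fun ω => 𝒰.indicator 1 (cluster ends ω a₁) * beta p ends a₂ b (cluster ends ω a₁) *
        (avoidAll ends a₁ {a₂, a₃}).indicator 1 ω) := by
  rw [← Ub_event_eq, prob_clusterIn_inter_avoid_eq_expect p ends a₁ a₂ (X := {a₂, a₃})
    (Finset.mem_insert_self a₂ {a₃})]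
  rfl

omit [LinearOrder R] [IsStrictOrderedRing R] in
/-- Tower identity: `P(b ∈ C₁, C₁ ∈ 𝒰, T) = E[1_𝒰(C₁) 1_b(C₁) (1 − u(C₁)); R]`. -/
lemma tower_UbT (p : E → R) (ends : E → Sym2 V) (a₁ a₂ a₃ b : V) (𝒰 : Set (Set V)) :
    prob p (connEvent ends a₁ b ∩ clusterInEvent ends a₁ 𝒰 ∩ TEvent ends a₁ a₂ a₃) =
      expect p (fun ω => 𝒰.indicator 1 (cluster ends ω a₁) * ind b (cluster ends ω a₁) *
        (1 - u p ends a₂ a₃ (cluster ends ω a₁)) * (avoidAll ends a₁ {a₂, a₃}).indicator 1 ω) := by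
  rw [← UbT_event_eq, prob_clusterIn_inter_avoid_eq_expect p ends a₁ a₂ (X := {a₂, a₃})
    (Finset.mem_insert_self a₂ {a₃})]
  simp only [one_sub_u, Set.inter_indicator_one, Pi.mul_apply]
  rfl

omit [LinearOrder R] [IsStrictOrderedRing R] in
/-- Tower identity: `P(PD, C₁ ∈ 𝒰) = E[1_𝒰(C₁) u(C₁); R]`. -/
lemma tower_PDU (p : E → R) (ends : E → Sym2 V) (a₁ a₂ a₃ : V) (𝒰 : Set (Set V)) :
    prob p (PDEvent ends a₁ a₂ a₃ ∩ clusterInEvent ends a₁ 𝒰) =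
      expect p (fun ω => 𝒰.indicator 1 (cluster ends ω a₁) * u p ends a₂ a₃ (cluster ends ω a₁) *
        (avoidAll ends a₁ {a₂, a₃}).indicator 1 ω) := by
  rw [← PDU_event_eq, prob_clusterIn_inter_avoid_eq_expect p ends a₁ a₂ (X := {a₂, a₃})
    (Finset.mem_insert_self a₂ {a₃})]
  rfl

omit [LinearOrder R] [IsStrictOrderedRing R] in
/-- Tower identity for the signed weight:
`P(b ∈ C₂, C₁ ∈ 𝒰, R) − P(b ∈ C₁, C₁ ∈ 𝒰, T) = E[1_𝒰(C₁) ψ(C₁); R]`. -/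
lemma tower_Upsi (p : E → R) (ends : E → Sym2 V) (a₁ a₂ a₃ b : V) (𝒰 : Set (Set V)) :
    prob p (connEvent ends a₂ b ∩ clusterInEvent ends a₁ 𝒰 ∩ avoidAll ends a₁ {a₂, a₃}) -
        prob p (connEvent ends a₁ b ∩ clusterInEvent ends a₁ 𝒰 ∩ TEvent ends a₁ a₂ a₃) =
      expect p (fun ω => 𝒰.indicator 1 (cluster ends ω a₁) * psi p ends a₂ a₃ b (cluster ends ω a₁) *
        (avoidAll ends a₁ {a₂, a₃}).indicator 1 ω) := by
  rw [tower_Ub, tower_UbT]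
  unfold expect
  rw [← Finset.sum_sub_distrib]
  refine Finset.sum_congr rfl fun ω _ => ?_
  unfold psi
  ring

end SDEvents

section SDFacts

variable {V : Type*} {E : Type*} [Fintype E] [DecidableEq E] [Fintype V] [DecidableEq V]
  {R : Type*} [Field R] [LinearOrder R] [IsStrictOrderedRing R]

omit [IsStrictOrderedRing R] in
/-- The up-set form at `𝒰` is the functional form at `F = 1_𝒰`. -/
theorem SDLight_iff_fun (p : E → R) (ends : E → Sym2 V) (a₁ a₂ a₃ b : V) (𝒰 : Set (Set V)) :
    SDLight p ends a₁ a₂ a₃ b 𝒰 ↔ SDLightFun p ends a₁ a₂ a₃ b (𝒰.indicator 1) := by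
  unfold SDLight SDLightFun
  rw [tower_Upsi, tower_PDU]

omit [Fintype V] in
/-- **The principal up-set `{S | o ∈ S}` is exactly (Yu1Δ)**: `SDLight {S | o ∈ S} ↔ Yu1Delta`. -/
theorem SDLight_principal_iff (p : E → R) (ends : E → Sym2 V) (o a₁ a₂ a₃ b : V) :
    SDLight p ends a₁ a₂ a₃ b {S | o ∈ S} ↔ Yu1Delta p ends o a₁ a₂ a₃ b := by
  unfold SDLight Yu1Delta
  rw [clusterInEvent_principal]
  have e1 : connEvent ends a₂ b ∩ connEvent ends a₁ o ∩ avoidAll ends a₁ {a₂, a₃} =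
      connEvent ends a₁ o ∩ connEvent ends a₂ b ∩ avoidAll ends a₁ {a₂, a₃} := by
    rw [Set.inter_comm (connEvent ends a₂ b)]
  have e2 : connEvent ends a₁ b ∩ connEvent ends a₁ o ∩ TEvent ends a₁ a₂ a₃ =
      connEvent ends a₁ o ∩ connEvent ends a₁ b ∩ TEvent ends a₁ a₂ a₃ := by
    rw [Set.inter_comm (connEvent ends a₁ b)]
  rw [e1, e2, ← Tlh_sub_deltaL]
  constructor
  · intro h
    linarith
  · intro h
    linarith

omit [Fintype V] [IsStrictOrderedRing R] in
/-- `𝒰 = univ`: (SD)_l holds with **equality** (`Λ(Ω) = W / P(PD)`). -/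
theorem SDLight_univ (p : E → R) (ends : E → Sym2 V) (a₁ a₂ a₃ b : V) :
    SDLight p ends a₁ a₂ a₃ b Set.univ := by
  unfold SDLight
  rw [clusterInEvent_univ]
  simp only [Set.inter_univ]
  apply le_of_eq
  rw [Nh_eq p ends a₁ a₂ a₃ b]
  unfold deltaT
  ring

omit [Fintype V] in
/-- (Yu1Δ) follows from (SD)_l on up-sets. -/
theorem Yu1Delta_of_SDLightUp (p : E → R) (ends : E → Sym2 V) (o a₁ a₂ a₃ b : V)
    (h : SDLightUp p ends a₁ a₂ a₃ b) : Yu1Delta p ends o a₁ a₂ a₃ b :=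
  (SDLight_principal_iff p ends o a₁ a₂ a₃ b).1 (h _ (fun _ _ hST ho => hST ho))

/-- The up-set form follows from the increasing-functional form. -/
theorem SDLightUp_of_funUp (p : E → R) (ends : E → Sym2 V) (a₁ a₂ a₃ b : V)
    (h : SDLightFunUp p ends a₁ a₂ a₃ b) : SDLightUp p ends a₁ a₂ a₃ b := by
  intro 𝒰 h𝒰
  rw [SDLight_iff_fun]
  refine h _ (fun S S' hSS' => ?_) (fun S => Set.indicator_nonneg (fun _ _ => zero_le_one) S)
  by_cases hS : S ∈ 𝒰
  · have hS' : S' ∈ 𝒰 := h𝒰 hSS' hS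
    simp [hS, hS']
  · simp [hS]
    exact Set.indicator_nonneg (fun _ _ => zero_le_one) S'

end SDFacts

section SDClosures

variable (R : Type*) [Field R] [LinearOrder R] [IsStrictOrderedRing R]

/-- **(SD)_l on up-sets for every finite graph**, hypothesis-free (`Yu1Delta_all`'s distinctness
list, `o` replaced by the family). -/
def SDLightUp_all : Prop :=
  ∀ (V E : Type) [Fintype V] [DecidableEq V] [Fintype E] [DecidableEq E]
    (ends : E → Sym2 V) (p : E → R), IsProbVec p →
    ∀ a₁ a₂ a₃ b : V, a₁ ≠ a₂ → a₁ ≠ a₃ → a₂ ≠ a₃ → b ≠ a₁ → b ≠ a₂ → b ≠ a₃ →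
      SDLightUp p ends a₁ a₂ a₃ b

/-- **(SD)_h on up-sets for every finite graph** under the labelling `P(b ↔ a₁) ≤ P(b ↔ a₂)`
(the heavy side needs it: engine D27 / mine-2 §20). -/
def SDHeavyUp_all : Prop :=
  ∀ (V E : Type) [Fintype V] [DecidableEq V] [Fintype E] [DecidableEq E]
    (ends : E → Sym2 V) (p : E → R), IsProbVec p →
    ∀ a₁ a₂ a₃ b : V, a₁ ≠ a₂ → a₁ ≠ a₃ → a₂ ≠ a₃ → b ≠ a₁ → b ≠ a₂ → b ≠ a₃ →
      prob p (connEvent ends a₁ b) ≤ prob p (connEvent ends a₂ b) →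
      SDHeavyUp p ends a₁ a₂ a₃ b

/-- `SDLightUp_all → Yu1Delta_all`. -/
theorem Yu1Delta_all_of_SDLightUp_all (h : SDLightUp_all R) : Yu1Delta_all R := by
  intro V E _ _ _ _ ends p hp o a₁ a₂ a₃ b h12 h13 h23 _ _ _ _ hb1 hb2 hb3
  exact Yu1Delta_of_SDLightUp p ends o a₁ a₂ a₃ b (h V E ends p hp a₁ a₂ a₃ b h12 h13 h23 hb1 hb2 hb3)

end SDClosures

end Summit.Ventures.PercRepro2
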